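import Summits.Ventures.CertifiedManyBodySolver.Rows.CorrWindowCertDictionaryFsum
import HarnessLib

/-!
# Kernel-replay OBJECTIVE dictionary on a WIDE letter window: the indexed f-sum word `fsumTermsIdx tp ix` read with letters in ANY
# `Λ' ⊇ Λ₇ = box 2 7` IS the embedded objective `Γ(incl h7)(−X₀(tp))` (cell `pub/hubbard-obs` × `pub/hubbard-downfold`, D-0154 (1)(C)
# COVERAGE La214; seat `hubbard-cov-la214-unc-2`, lineage desk; zero compute)

HONEST FRAMING: Lean plumbing towards «tier P». `Rows/CorrWindowCertDictionaryFsum.lean` (p671777) proves the objective dictionary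
`termOp d (fsumTermsIdx tp ix) = −oddMomentObsTT tp U 0` for letters INTO `box 2 7`; the exporter's instances and the WIDE pair consumers
(`Downfold/TPrimePinnedPairRowKernelWide.lean` p678325 and its chain twins) read letters in a larger outer table `Λ'` (e.g. `box 2 12`, N = 625)
and ask for the objective as the EMBEDDED word `hX : termOp d TX = fermionEmbed (PolySite.incl h7) (X s)`. This file is that one theorem:
`termOp_fsumTermsIdx_wide`. Nothing is asserted: no `def`, no named fact, no `sorry`, no number; CONTROL / CALIBRATION wording class (xx1);
no summit statement is proved by this file.

References: D. J. Scalapino, S. R. White, S. Zhang, Phys. Rev. B 47 (1993) 7995, §II (the kinetic/f-sum bond word) [ScalapinoWhiteZhang1993];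
E. Lipparini, *Modern Many-Particle Physics* (2008) eq. (8.30) [Lipparini2008]; O. Bratteli, D. W. Robinson, *Operator Algebras and Quantum
Statistical Mechanics 2* §5.2.2 (functoriality of the local embeddings) [BratteliRobinsonII1997].
-/

noncomputable section

namespace Summit.Ventures.CertifiedManyBodySolver

namespace CARPolyWindow

open Summit.Ventures.CertifiedQuantumChemistry Summit.Ventures.CertifiedQuantumChemistry.CARPoly
open Literature.MathematicalPhysics.QuantumLattice Literature.MathematicalPhysics.QuantumLattice.HubbardWave0
open Literature.Probability.LatticeModels
open Summit.Ventures.CertifiedManyBodySolver.Observables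
open Matrix
open scoped ComplexOrder BigOperators

/-! ## The wide dictionary theorem -/

section DictionaryWide

variable {N : ℕ}

/-- Membership-proof irrelevance for ordered sites. [folklore] -/
private theorem pt_congr_site_wide {Λ' : Finset (Site 2)} {x y : Site 2} (hx : x ∈ Λ') (hy : y ∈ Λ') (h : x = y) :
    PolySite.pt x hx = PolySite.pt y hy := by
  subst h; rfl

/-- **WIDE DICTIONARY: the indexed three-bond list IS the EMBEDDED f-sum objective word at `λ = 0`.** For an enumeration `xs : Fin N → ℤ²` of sites
of ANY window `Λ' ⊇ box 2 7`, the letter map `d (i, σ) = (xs i, σ)` and an index reader `ix` with `xs (ix v) = v` on `box 2 1`: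
`termOp d (fsumTermsIdx tp ix) = Γ(incl h7)(−oddMomentObsTT tp U 0)` (every `U`) — the `hX` hypothesis of the wide pair consumers for the own
f-sum objective. [cite: ScalapinoWhiteZhang1993, §II] [cite: Lipparini2008, eq. (8.30)] [cite: BratteliRobinsonII1997, §5.2.2] -/
theorem termOp_fsumTermsIdx_wide (tp : ℚ) (U : ℝ) {Λ' : Finset (Site 2)} (h7 : box 2 7 ⊆ Λ') (xs : Fin N → Site 2)
    (hmem : ∀ i, xs i ∈ Λ') (ix : Site 2 → Fin N) (hix : ∀ v ∈ box 2 1, xs (ix v) = v)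
    (d : Orb (Fin N) → Orb (PolySite Λ')) (hd : ∀ i σ, d (orb i σ) = orb (PolySite.pt (xs i) (hmem i)) σ) :
    termOp d (fsumTermsIdx tp ix) = fermionEmbed (PolySite.incl h7) (-oddMomentObsTT (tp : ℝ) U 0) := by
  -- the indexed orbitals and membership-proof irrelevance on `box 2 1`
  set P : Site 2 → PolySite Λ' := fun v => PolySite.pt (xs (ix v)) (hmem (ix v)) with hP
  have h17 : box 2 1 ⊆ box 2 7 := box_subset_box (by norm_num)
  have h1Λ : box 2 1 ⊆ Λ' := h17.trans h7
  have hpt : ∀ (v : Site 2) (hv : v ∈ box 2 1) (hv' : v ∈ Λ'), PolySite.pt v hv' = P v := by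
    intro v hv hv'
    exact pt_congr_site_wide hv' (hmem (ix v)) (hix v hv).symm
  -- (1) the syntactic side
  have hL : termOp d (fsumTermsIdx tp ix) =
      (((-1 / 2 : ℚ)) : ℂ) • ∑ σ : Fin 2,
          (creation (orb (P (unitVec 0)) σ) * annihilation (orb (P 0) σ) + creation (orb (P 0) σ) * annihilation (orb (P (unitVec 0)) σ)) +
        ∑ s : Fin 2, (((-tp / 2 : ℚ)) : ℂ) • ∑ σ : Fin 2,
          (creation (orb (P (diagVec s)) σ) * annihilation (orb (P 0) σ) + creation (orb (P 0) σ) * annihilation (orb (P (diagVec s)) σ)) := by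
    rw [fsumTermsIdx, termOp_append, termOp_bondT xs hmem d hd, termOp_flatMap_finL]
    refine congrArg _ (Finset.sum_congr rfl fun s _ => ?_)
    rw [termOp_bondT xs hmem d hd]
  -- (2) the semantic side: `Γ(incl h7) X₀ = ½ Γ(incl h1Λ)(kinBondObsTT tp)` (functoriality), then the bonds in creation/annihilation form
  have hbond : ∀ (x : Site 2) (hx : x ∈ box 2 1) (σ : Fin 2),
      fermionEmbed (PolySite.incl h1Λ) ((cAt x hx σ)ᴴ * cAt 0 zero_mem_box_one σ + (cAt 0 zero_mem_box_one σ)ᴴ * cAt x hx σ) =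
        creation (orb (P x) σ) * annihilation (orb (P 0) σ) + creation (orb (P 0) σ) * annihilation (orb (P x) σ) := by
    intro x hx σ
    rw [map_add, map_mul, map_mul, fermionEmbed_conjTranspose, fermionEmbed_conjTranspose, fermionEmbed_incl_cAt,
      fermionEmbed_incl_cAt, cAt, cAt, annihilation_conjTranspose, annihilation_conjTranspose, hpt x hx, hpt 0 zero_mem_box_one]
  have hbond1 : ∀ σ : Fin 2,
      fermionEmbed (PolySite.incl h1Λ) ((cAt (unitVec 0) unitVec_zero_mem_box_one σ)ᴴ * cAt 0 zero_mem_box_one σ +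
          (cAt 0 zero_mem_box_one σ)ᴴ * cAt (unitVec 0) unitVec_zero_mem_box_one σ) =
        creation (orb (P (unitVec 0)) σ) * annihilation (orb (P 0) σ) + creation (orb (P 0) σ) * annihilation (orb (P (unitVec 0)) σ) :=
    fun σ => hbond (unitVec 0) unitVec_zero_mem_box_one σ
  have hbond2 : ∀ (s σ : Fin 2),
      fermionEmbed (PolySite.incl h1Λ) ((cAt (diagVec s) (diagVec_mem_box_one s) σ)ᴴ * cAt 0 zero_mem_box_one σ +
          (cAt 0 zero_mem_box_one σ)ᴴ * cAt (diagVec s) (diagVec_mem_box_one s) σ) =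
        creation (orb (P (diagVec s)) σ) * annihilation (orb (P 0) σ) + creation (orb (P 0) σ) * annihilation (orb (P (diagVec s)) σ) :=
    fun s σ => hbond (diagVec s) (diagVec_mem_box_one s) σ
  have hemb : fermionEmbed (PolySite.incl h7) (fermionEmbed (PolySite.incl h17) (kinBondObsTT ((tp : ℚ) : ℝ))) =
      fermionEmbed (PolySite.incl h1Λ) (kinBondObsTT ((tp : ℚ) : ℝ)) := by
    rw [fermionEmbed_fermionEmbed]
    exact congrFun (congrArg DFunLike.coe (fermionEmbed_congr fun y => rfl)) _
  have hX0 : fermionEmbed (PolySite.incl h7) (oddMomentObsTT ((tp : ℚ) : ℝ) U 0) =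
      (((1 / 2 : ℝ)) : ℂ) • fermionEmbed (PolySite.incl h1Λ) (kinBondObsTT ((tp : ℚ) : ℝ)) := by
    unfold oddMomentObsTT
    simp only [Complex.ofReal_zero, zero_smul, add_zero, ne_eq, OfNat.ofNat_ne_zero, not_false_eq_true, zero_pow, zero_div,
      sub_zero, map_smul]
    rw [hemb]
  have hk : fermionEmbed (PolySite.incl h1Λ) (kinBondObsTT ((tp : ℚ) : ℝ)) =
      ∑ σ : Fin 2, (creation (orb (P (unitVec 0)) σ) * annihilation (orb (P 0) σ) +
          creation (orb (P 0) σ) * annihilation (orb (P (unitVec 0)) σ)) +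
        ((((tp : ℚ) : ℝ) : ℝ) : ℂ) • ∑ s : Fin 2, ∑ σ : Fin 2,
          (creation (orb (P (diagVec s)) σ) * annihilation (orb (P 0) σ) + creation (orb (P 0) σ) * annihilation (orb (P (diagVec s)) σ)) := by
    unfold kinBondObsTT kinBondObs
    rw [map_add, map_sum, map_smul, map_sum]
    simp_rw [map_sum, hbond1, hbond2]
  have hR : fermionEmbed (PolySite.incl h7) (-oddMomentObsTT (tp : ℝ) U 0) =
      (((-1 / 2 : ℚ)) : ℂ) • ∑ σ : Fin 2,
          (creation (orb (P (unitVec 0)) σ) * annihilation (orb (P 0) σ) + creation (orb (P 0) σ) * annihilation (orb (P (unitVec 0)) σ)) +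
        ∑ s : Fin 2, (((-tp / 2 : ℚ)) : ℂ) • ∑ σ : Fin 2,
          (creation (orb (P (diagVec s)) σ) * annihilation (orb (P 0) σ) + creation (orb (P 0) σ) * annihilation (orb (P (diagVec s)) σ)) := by
    have ec1 : -(((1 / 2 : ℝ)) : ℂ) = (((-1 / 2 : ℚ)) : ℂ) := by push_cast; ring
    have ec2 : -((((1 / 2 : ℝ)) : ℂ) * ((((tp : ℚ) : ℝ) : ℝ) : ℂ)) = (((-tp / 2 : ℚ)) : ℂ) := by push_cast; ring
    rw [map_neg, hX0, hk, smul_add, smul_smul, neg_add, ← neg_smul, ← neg_smul, ec1, ec2, Finset.smul_sum, Finset.smul_sum]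
  rw [hL, hR]

end DictionaryWide

end CARPolyWindow

end Summit.Ventures.CertifiedManyBodySolver

end
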